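import Mathlib.Algebra.Order.Field.Basic
import Mathlib.Data.Real.Basic
import Mathlib.Tactic.Linarith
import Mathlib.Tactic.Positivity

/-!
# Stub `stub_budgetAlgebra` (B) of the line `Sketch`
# (crux stmt-AnomalousDissipation-14086, `TaylorCertificates.FloorCertificateEnsembleCeiling`)

THE CUBIC BUDGET DOMINATES A QUADRATIC TAX. The line proves the route target from an energy-taxed
floor certificate with quadratic budget `ε₁ + κ |u|²`; the original species of the certificate
carries the cubic (Kolmogorov-scaling) budget `max ε₀ (β |u|³)`. This file proves the pointwise
real inequality that makes the cubic certificate a sufficient entrance to the line: for all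
`ε₀, β > 0` there are `ε₁, κ > 0` with

`ε₁ + κ r² ≤ max ε₀ (β r³)` for every `r ≥ 0`

(the skeleton's `taxed_of_cubic` applies it with `r = ‖u‖`).

Proof. Take `ε₁ = ε₀ / 2` and `κ = min (ε₀ / 2) (β / 2)`. If `r ≤ 1` then `r² ≤ 1`, so
`κ r² ≤ κ ≤ ε₀ / 2` and `ε₁ + κ r² ≤ ε₀ ≤ max ε₀ (β r³)`. If `1 ≤ r` then `r² ≤ r³`, so
`κ r² ≤ κ r³ ≤ β r³ / 2` and `ε₁ + κ r² ≤ (ε₀ + β r³) / 2 ≤ max ε₀ (β r³)`.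
Elementary real algebra; Mathlib only (`pow_le_one₀`, `pow_le_pow_right₀`, `linarith`).
No fluid mechanics is used or stated here.
-/

set_option linter.dupNamespace false

namespace Summit.AnomalousDissipation.AnomalousDissipation.Theorems.TaylorCertificatesFloorCertificateEnsembleCeiling

/-- **B `stub_budgetAlgebra`** — THE CUBIC BUDGET DOMINATES A QUADRATIC TAX: for `ε₀, β > 0` there
are `ε₁, κ > 0` with `ε₁ + κ r² ≤ max ε₀ (β r³)` for all `r ≥ 0`. Witnesses: `ε₁ = ε₀ / 2`,
`κ = min (ε₀ / 2) (β / 2)`; for `r ≤ 1` use `κ r² ≤ κ ≤ ε₀ / 2`, for `1 ≤ r` use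
`κ r² ≤ κ r³ ≤ β r³ / 2` and `(ε₀ + β r³) / 2 ≤ max ε₀ (β r³)`. [folklore] -/
theorem stub_budgetAlgebra :
    ∀ ε₀ β : ℝ, 0 < ε₀ → 0 < β →
      ∃ ε₁ κ : ℝ, 0 < ε₁ ∧ 0 < κ ∧ ∀ r : ℝ, 0 ≤ r → ε₁ + κ * r ^ 2 ≤ max ε₀ (β * r ^ 3) := by
  intro ε₀ β hε₀ hβ
  -- the tax rate `κ`: only `0 < κ ≤ ε₀ / 2` and `κ ≤ β / 2` are used below
  obtain ⟨κ, hκ0, hκε, hκβ⟩ : ∃ κ : ℝ, 0 < κ ∧ κ ≤ ε₀ / 2 ∧ κ ≤ β / 2 :=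
    ⟨min (ε₀ / 2) (β / 2), lt_min (by positivity) (by positivity), min_le_left _ _,
      min_le_right _ _⟩
  refine ⟨ε₀ / 2, κ, by positivity, hκ0, fun r hr => ?_⟩
  have h₁ := le_max_left ε₀ (β * r ^ 3)
  rcases le_total r 1 with hr1 | hr1
  · -- small energies: the constant part `ε₀` of the budget pays the tax
    have hr2 : r ^ 2 ≤ 1 := pow_le_one₀ hr hr1
    have hκr := mul_le_mul_of_nonneg_left hr2 hκ0.le
    linarith
  · -- large energies: the cubic part `β r³` of the budget pays the tax
    have hr23 : r ^ 2 ≤ r ^ 3 := pow_le_pow_right₀ hr1 (by norm_num)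
    have h₂ := le_max_right ε₀ (β * r ^ 3)
    have hκr := mul_le_mul_of_nonneg_left hr23 hκ0.le
    have hβr := mul_le_mul_of_nonneg_right hκβ (by positivity : (0 : ℝ) ≤ r ^ 3)
    linarith

end Summit.AnomalousDissipation.AnomalousDissipation.Theorems.TaylorCertificatesFloorCertificateEnsembleCeiling
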